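import Summits.AtomisticToContinuum.FouriersLaw.Theorems.PhononMeanFreePathDefs
import Mathlib.Probability.Distributions.Gaussian.Real

/-!
# Light-cone stub, helper 1: under the Gibbs state every momentum is an independent `N(0,T)`

Helper for the registered stub `stub_lightCone` of line `two-horizons-forecast-loss`
(crux `PhononMeanFreePath.IncoherentChannel`, stmt-AtomisticToContinuum-11811).

The Gibbs measure `μ₀ = Z⁻¹ e^{-H/T} dq dp` of `pinnedChain ω₂ lam β γ` has
`H = ∑ p_j²/2 + Φ(q)`, so the momentum `p_i` is EXACTLY `N(0,T)` and independent of all positions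
and all other momenta. We prove this in the form used by the light-cone reduction: RESAMPLING
INVARIANCE. Let `ν = gaussianReal 0 T` and, for `x = (z, s) ∈ PhaseSpace (n+1) × ℝ`, let
`Ψ x = ((z.1, update z.2 i s), z.2 i)` (replace `p_i` by the fresh Gaussian `s`, remember the old
`p_i`). Then `(μ₀ ⊗ ν).map Ψ = μ₀ ⊗ ν` (`lightCone_gibbs_swap_invariance`, the registered helper
statement): the resampled microstate is again `μ₀`-distributed and independent of the discarded
momentum, which is `N(0,T)`. Corollaries: `(μ₀ ⊗ ν).map resample = μ₀`, the `p_i`-marginal of `μ₀`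
is `ν`, and the pair `(p_i, resampled state)` has law `ν ⊗ μ₀`.

Proof: disintegrate Lebesgue measure on `Fin (n+1) → ℝ` along the coordinate `i`
(`volume_preserving_piFinSuccAbove`), split `e^{-H/T} = e^{-a²/(2T)} · e^{-(∑_{j≠i} p_j²/2 + Φ)/T}`
(`a = p_i`), and use the symmetry `e^{-a²/(2T)} φ_T(s) = e^{-s²/(2T)} φ_T(a)` of the product of the
two Gaussian weights plus Tonelli.
-/

noncomputable section

namespace Summit.AtomisticToContinuum.FouriersLaw.Theorems.PhononMeanFreePath

open MeasureTheory ProbabilityTheory Set Filter Topology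
open scoped NNReal ENNReal
open Literature.MathematicalPhysics.KineticTheory.HeatConduction

variable {ω₂ lam β γ T : ℝ} {n : ℕ}

/-! ### Splitting off one momentum coordinate -/

/-- The inverse of `piFinSuccAbove` inserts the distinguished coordinate. -/
theorem lightCone_piFinSuccAbove_symm_apply (i : Fin (n + 1)) (y : ℝ × (Fin n → ℝ)) :
    (MeasurableEquiv.piFinSuccAbove (fun _ : Fin (n + 1) => ℝ) i).symm y = Fin.insertNth i y.1 y.2 :=
  rfl

/-- `H(q, insertNth i a f) = a²/2 + (∑_j f_j²/2 + Φ(q))`: the kinetic energy of the distinguished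
momentum splits off. -/
theorem lightCone_hamiltonian_insertNth (P : OscillatorChain) (i : Fin (n + 1)) (q : Fin (n + 1) → ℝ)
    (a : ℝ) (f : Fin n → ℝ) :
    P.hamiltonian (n + 1) (q, Fin.insertNth i a f) =
      a ^ 2 / 2 + ((∑ j, f j ^ 2 / 2) + P.potential (n + 1) q) := by
  rw [P.hamiltonian_eq_kinetic_add_potential, Fin.sum_univ_succAbove _ i]
  simp only [Fin.insertNth_apply_same, Fin.insertNth_apply_succAbove]
  ring

/-- The Gibbs weight splits: `e^{-H/T} = e^{-a²/(2T)} · e^{-(∑_j f_j²/2 + Φ(q))/T}`. -/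
theorem lightCone_gibbsDensity_insertNth (P : OscillatorChain) (i : Fin (n + 1)) (T : ℝ)
    (q : Fin (n + 1) → ℝ) (a : ℝ) (f : Fin n → ℝ) :
    ENNReal.ofReal (P.gibbsDensity (n + 1) T (q, Fin.insertNth i a f)) =
      ENNReal.ofReal (Real.exp (-(a ^ 2 / 2) / T)) *
        ENNReal.ofReal (Real.exp (-((∑ j, f j ^ 2 / 2) + P.potential (n + 1) q) / T)) := by
  rw [OscillatorChain.gibbsDensity, lightCone_hamiltonian_insertNth,
    ← ENNReal.ofReal_mul (Real.exp_nonneg _), ← Real.exp_add]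
  congr 2
  ring

/-- Symmetry of the product of the two Gaussian weights:
`e^{-a²/(2T)} φ_T(s) = e^{-s²/(2T)} φ_T(a)`. -/
theorem lightCone_gaussWeight_symm (hT : 0 < T) (a s : ℝ) :
    ENNReal.ofReal (Real.exp (-(a ^ 2 / 2) / T)) * gaussianPDF 0 T.toNNReal s =
      ENNReal.ofReal (Real.exp (-(s ^ 2 / 2) / T)) * gaussianPDF 0 T.toNNReal a := by
  simp only [gaussianPDF, gaussianPDFReal, Real.coe_toNNReal _ hT.le, sub_zero]
  rw [← ENNReal.ofReal_mul (Real.exp_nonneg _), ← ENNReal.ofReal_mul (Real.exp_nonneg _)]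
  congr 1
  have h1 : -(a ^ 2 / 2) / T = -a ^ 2 / (2 * T) := by ring
  have h2 : -(s ^ 2 / 2) / T = -s ^ 2 / (2 * T) := by ring
  rw [h1, h2]
  ring

/-! ### Disintegration of `μ₀ ⊗ ν` along the momentum `p_i` -/

section Disintegration

variable (hω : 0 < ω₂) (hl : 0 ≤ lam) (hβ : 0 ≤ β) (hT : 0 < T)
include hω hl hβ hT

/-- **Disintegration formula.** For measurable `G ≥ 0`,
`∫ G d(μ₀ ⊗ ν) = Z⁻¹ ∫ dq ∫ df e^{-(∑_j f_j²/2 + Φ(q))/T} ∫ da ∫ ds e^{-a²/(2T)} φ_T(s) G((q, insertNth i a f), s)`. -/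
theorem lightCone_lintegral_gibbs_prod_gaussian (i : Fin (n + 1))
    {G : PhaseSpace (n + 1) × ℝ → ℝ≥0∞} (hG : Measurable G) :
    ∫⁻ x, G x ∂(((pinnedChain ω₂ lam β γ).gibbsMeasure (n + 1) T).prod (gaussianReal 0 T.toNNReal)) =
      ((pinnedChain ω₂ lam β γ).partitionFunction (n + 1) T)⁻¹ *
        ∫⁻ q : Fin (n + 1) → ℝ, ∫⁻ f : Fin n → ℝ,
          ENNReal.ofReal (Real.exp (-((∑ j, f j ^ 2 / 2) +
            (pinnedChain ω₂ lam β γ).potential (n + 1) q) / T)) *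
            ∫⁻ a : ℝ, ∫⁻ s : ℝ, ENNReal.ofReal (Real.exp (-(a ^ 2 / 2) / T)) *
              (gaussianPDF 0 T.toNNReal s * G ((q, Fin.insertNth i a f), s)) := by
  set P := pinnedChain ω₂ lam β γ with hP
  set ν := gaussianReal 0 T.toNNReal with hν
  have hv : T.toNNReal ≠ 0 := by
    rw [Ne, Real.toNNReal_eq_zero]; exact not_le.2 hT
  have hint : Integrable (P.gibbsDensity (n + 1) T) :=
    pinnedChain_integrable_gibbsDensity hω hl hβ γ (n + 1) hT
  have hρm : Measurable fun z => ENNReal.ofReal (P.gibbsDensity (n + 1) T z) :=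
    (pinnedChain_continuous_gibbsDensity ω₂ lam β γ (n + 1) T).measurable.ennreal_ofReal
  have hΦm : Measurable fun z : PhaseSpace (n + 1) => ∫⁻ s, G (z, s) ∂ν := hG.lintegral_prod_right'
  have hνs : ∀ z : PhaseSpace (n + 1), ∫⁻ s, G (z, s) ∂ν =
      ∫⁻ s, gaussianPDF 0 T.toNNReal s * G (z, s) := by
    intro z
    rw [hν, gaussianReal_of_var_ne_zero _ hv, lintegral_withDensity_eq_lintegral_mul _
      (measurable_gaussianPDF _ _) (show Measurable (fun s => G (z, s)) from
        hG.comp (measurable_const.prodMk measurable_id))]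
    rfl
  rw [lintegral_prod _ hG.aemeasurable, P.gibbsMeasure_eq_smul_withDensity hint, lintegral_smul_measure,
    lintegral_withDensity_eq_lintegral_mul _ hρm hΦm]
  congr 1
  rw [show (volume : Measure (PhaseSpace (n + 1))) = volume.prod volume from rfl,
    lintegral_prod _ ((hρm.mul hΦm).aemeasurable)]
  refine lintegral_congr fun q => ?_
  have hmp := (volume_preserving_piFinSuccAbove (fun _ : Fin (n + 1) => ℝ) i).symm
  have hqm : Measurable fun y : ℝ × (Fin n → ℝ) =>
      ((q, (MeasurableEquiv.piFinSuccAbove (fun _ : Fin (n + 1) => ℝ) i).symm y) : PhaseSpace (n + 1)) :=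
    measurable_const.prodMk (MeasurableEquiv.measurable _)
  rw [← hmp.lintegral_comp_emb (MeasurableEquiv.measurableEmbedding _),
    show (volume : Measure (ℝ × (Fin n → ℝ))) = volume.prod volume from rfl,
    lintegral_prod_symm' _ (show Measurable (fun y : ℝ × (Fin n → ℝ) =>
      ((fun z => ENNReal.ofReal (P.gibbsDensity (n + 1) T z)) * fun z => ∫⁻ s, G (z, s) ∂ν)
        (q, (MeasurableEquiv.piFinSuccAbove (fun _ : Fin (n + 1) => ℝ) i).symm y)) from
      (hρm.mul hΦm).comp hqm)]
  refine lintegral_congr fun f => ?_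
  simp only [Pi.mul_apply, lightCone_piFinSuccAbove_symm_apply]
  have hR : ENNReal.ofReal (Real.exp (-((∑ j, f j ^ 2 / 2) + P.potential (n + 1) q) / T)) ≠ ∞ :=
    ENNReal.ofReal_ne_top
  rw [← lintegral_const_mul' _ _ hR]
  refine lintegral_congr fun a => ?_
  rw [lightCone_gibbsDensity_insertNth, hνs, ← lintegral_const_mul' _ _ hR,
    ← lintegral_const_mul' _ _ (ENNReal.mul_ne_top ENNReal.ofReal_ne_top hR)]
  refine lintegral_congr fun s => ?_
  ring

/-- **Resampling (swap) invariance at the level of Lebesgue integrals**: for measurable `G ≥ 0`,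
`∫ G(Ψ x) d(μ₀ ⊗ ν) = ∫ G d(μ₀ ⊗ ν)` with `Ψ (z, s) = ((z.1, update z.2 i s), z.2 i)`. -/
theorem lightCone_lintegral_gibbs_swap (i : Fin (n + 1))
    {G : PhaseSpace (n + 1) × ℝ → ℝ≥0∞} (hG : Measurable G) :
    ∫⁻ x, G (((x.1.1, Function.update x.1.2 i x.2) : PhaseSpace (n + 1)), x.1.2 i)
        ∂(((pinnedChain ω₂ lam β γ).gibbsMeasure (n + 1) T).prod (gaussianReal 0 T.toNNReal)) =
      ∫⁻ x, G x ∂(((pinnedChain ω₂ lam β γ).gibbsMeasure (n + 1) T).prod (gaussianReal 0 T.toNNReal)) := by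
  have hΨ : Measurable fun x : PhaseSpace (n + 1) × ℝ =>
      ((((x.1.1, Function.update x.1.2 i x.2) : PhaseSpace (n + 1)), x.1.2 i) : PhaseSpace (n + 1) × ℝ) := by
    refine ((measurable_fst.comp measurable_fst).prodMk ?_).prodMk
      ((measurable_pi_apply i).comp (measurable_snd.comp measurable_fst))
    exact measurable_update'.comp ((measurable_snd.comp measurable_fst).prodMk measurable_snd)
  rw [lightCone_lintegral_gibbs_prod_gaussian hω hl hβ hT i (show Measurable (fun x : PhaseSpace (n + 1) × ℝ =>
      G ((((x.1.1, Function.update x.1.2 i x.2) : PhaseSpace (n + 1)), x.1.2 i) : PhaseSpace (n + 1) × ℝ)) from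
      hG.comp hΨ),
    lightCone_lintegral_gibbs_prod_gaussian hω hl hβ hT i hG]
  congr 1
  refine lintegral_congr fun q => lintegral_congr fun f => ?_
  congr 1
  -- the inner double integral: swap the roles of `a` and `s`
  have hins : ∀ a s : ℝ, Function.update (Fin.insertNth i a f : Fin (n + 1) → ℝ) i s = Fin.insertNth i s f :=
    fun a s => Fin.update_insertNth (α := fun _ : Fin (n + 1) => ℝ) i a s f
  simp only [hins, Fin.insertNth_apply_same]
  have hmeas : Measurable fun y : ℝ × ℝ => ENNReal.ofReal (Real.exp (-(y.2 ^ 2 / 2) / T)) *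
      (gaussianPDF 0 T.toNNReal y.1 * G ((q, Fin.insertNth i y.2 f), y.1)) := by
    refine (Measurable.ennreal_ofReal (by fun_prop)).mul (((measurable_gaussianPDF _ _).comp measurable_fst).mul
      (hG.comp ?_))
    refine (measurable_const.prodMk ?_).prodMk measurable_fst
    have h1 : Measurable fun y : ℝ × ℝ => ((y.2, f) : ℝ × (Fin n → ℝ)) := measurable_snd.prodMk measurable_const
    exact ((MeasurableEquiv.piFinSuccAbove (fun _ : Fin (n + 1) => ℝ) i).symm.measurable).comp h1
  calc ∫⁻ a, ∫⁻ s, ENNReal.ofReal (Real.exp (-(a ^ 2 / 2) / T)) *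
          (gaussianPDF 0 T.toNNReal s * G ((q, Fin.insertNth i s f), a))
      = ∫⁻ a, ∫⁻ s, ENNReal.ofReal (Real.exp (-(s ^ 2 / 2) / T)) *
          (gaussianPDF 0 T.toNNReal a * G ((q, Fin.insertNth i s f), a)) := by
        refine lintegral_congr fun a => lintegral_congr fun s => ?_
        rw [← mul_assoc, lightCone_gaussWeight_symm hT a s, mul_assoc]
    _ = ∫⁻ s, ∫⁻ a, ENNReal.ofReal (Real.exp (-(s ^ 2 / 2) / T)) *
          (gaussianPDF 0 T.toNNReal a * G ((q, Fin.insertNth i s f), a)) :=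
        lintegral_lintegral_swap hmeas.aemeasurable

end Disintegration

/-- **Registered helper `lightCone_gibbs_swap_invariance`.** Under the Gibbs state of the pinned
chain (`ω₂ > 0`, `lam, β ≥ 0`, `T > 0`, any `n`, any site `i`), replacing the momentum `p_i` by an
independent `N(0,T)` sample and remembering the old `p_i` preserves the product law
`μ₀ ⊗ N(0,T)`: the momentum `p_i` is an independent `N(0,T)` under `μ₀`. -/
theorem lightCone_gibbs_swap_invariance : ∀ ω₂ lam β γ : ℝ, 0 < ω₂ → 0 ≤ lam → 0 ≤ β → ∀ T : ℝ, 0 < T →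
    ∀ (n : ℕ) (i : Fin (n + 1)),
      (((pinnedChain ω₂ lam β γ).gibbsMeasure (n + 1) T).prod (ProbabilityTheory.gaussianReal 0 T.toNNReal)).map
        (fun x : PhaseSpace (n + 1) × ℝ => ((((x.1.1, Function.update x.1.2 i x.2) : PhaseSpace (n + 1)), x.1.2 i) :
          PhaseSpace (n + 1) × ℝ)) =
      ((pinnedChain ω₂ lam β γ).gibbsMeasure (n + 1) T).prod (ProbabilityTheory.gaussianReal 0 T.toNNReal) := by
  intro ω₂ lam β γ hω hl hβ T hT n i
  have hΨ : Measurable fun x : PhaseSpace (n + 1) × ℝ =>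
      ((((x.1.1, Function.update x.1.2 i x.2) : PhaseSpace (n + 1)), x.1.2 i) : PhaseSpace (n + 1) × ℝ) := by
    refine ((measurable_fst.comp measurable_fst).prodMk ?_).prodMk
      ((measurable_pi_apply i).comp (measurable_snd.comp measurable_fst))
    exact measurable_update'.comp ((measurable_snd.comp measurable_fst).prodMk measurable_snd)
  refine Measure.ext_of_lintegral _ fun G hG => ?_
  rw [lintegral_map hG hΨ]
  exact lightCone_lintegral_gibbs_swap hω hl hβ hT i hG



/-! ### Corollaries: the resampled state is `μ₀`, the momentum is `N(0,T)`, and they are independent -/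

section Corollaries

/-- Measurability of the resampling swap `Ψ`. -/
theorem lightCone_measurable_swap (i : Fin (n + 1)) :
    Measurable fun x : PhaseSpace (n + 1) × ℝ =>
      ((((x.1.1, Function.update x.1.2 i x.2) : PhaseSpace (n + 1)), x.1.2 i) : PhaseSpace (n + 1) × ℝ) := by
  refine ((measurable_fst.comp measurable_fst).prodMk ?_).prodMk
    ((measurable_pi_apply i).comp (measurable_snd.comp measurable_fst))
  exact measurable_update'.comp ((measurable_snd.comp measurable_fst).prodMk measurable_snd)

/-- Measurability of the resampling map `(z, s) ↦ (z.1, update z.2 i s)`. -/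
theorem lightCone_measurable_resample (i : Fin (n + 1)) :
    Measurable fun x : PhaseSpace (n + 1) × ℝ => ((x.1.1, Function.update x.1.2 i x.2) : PhaseSpace (n + 1)) :=
  (measurable_fst.comp measurable_fst).prodMk
    (measurable_update'.comp ((measurable_snd.comp measurable_fst).prodMk measurable_snd))

variable (hω : 0 < ω₂) (hl : 0 ≤ lam) (hβ : 0 ≤ β) (γ) (hT : 0 < T)
include hω hl hβ hT

/-- **The pair `(p_i, resampled state)` has law `N(0,T) ⊗ μ₀`** (independence with the right
marginals). -/
theorem lightCone_gibbs_map_momentum_resample (i : Fin (n + 1)) :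
    (((pinnedChain ω₂ lam β γ).gibbsMeasure (n + 1) T).prod (gaussianReal 0 T.toNNReal)).map
        (fun x : PhaseSpace (n + 1) × ℝ => (x.1.2 i, ((x.1.1, Function.update x.1.2 i x.2) : PhaseSpace (n + 1)))) =
      (gaussianReal 0 T.toNNReal).prod ((pinnedChain ω₂ lam β γ).gibbsMeasure (n + 1) T) := by
  haveI : IsProbabilityMeasure ((pinnedChain ω₂ lam β γ).gibbsMeasure (n + 1) T) :=
    pinnedChain_isProbabilityMeasure_gibbsMeasure hω hl hβ γ (n + 1) hT
  have h := lightCone_gibbs_swap_invariance ω₂ lam β γ hω hl hβ T hT n i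
  have hΨ := lightCone_measurable_swap i (n := n)
  have hcomp : (fun x : PhaseSpace (n + 1) × ℝ => (x.1.2 i, ((x.1.1, Function.update x.1.2 i x.2) : PhaseSpace (n + 1)))) =
      Prod.swap ∘ fun x : PhaseSpace (n + 1) × ℝ =>
        ((((x.1.1, Function.update x.1.2 i x.2) : PhaseSpace (n + 1)), x.1.2 i) : PhaseSpace (n + 1) × ℝ) := rfl
  rw [hcomp, ← Measure.map_map measurable_swap hΨ, h, Measure.prod_swap]

/-- **The resampled state is Gibbs**: `(μ₀ ⊗ ν).map resample = μ₀`. -/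
theorem lightCone_gibbs_map_resample (i : Fin (n + 1)) :
    (((pinnedChain ω₂ lam β γ).gibbsMeasure (n + 1) T).prod (gaussianReal 0 T.toNNReal)).map
        (fun x : PhaseSpace (n + 1) × ℝ => ((x.1.1, Function.update x.1.2 i x.2) : PhaseSpace (n + 1))) =
      (pinnedChain ω₂ lam β γ).gibbsMeasure (n + 1) T := by
  haveI : IsProbabilityMeasure ((pinnedChain ω₂ lam β γ).gibbsMeasure (n + 1) T) :=
    pinnedChain_isProbabilityMeasure_gibbsMeasure hω hl hβ γ (n + 1) hT
  have h := lightCone_gibbs_map_momentum_resample (γ := γ) hω hl hβ hT i (n := n)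
  have hm : Measurable fun x : PhaseSpace (n + 1) × ℝ =>
      (x.1.2 i, ((x.1.1, Function.update x.1.2 i x.2) : PhaseSpace (n + 1))) :=
    ((measurable_pi_apply i).comp (measurable_snd.comp measurable_fst)).prodMk
      (lightCone_measurable_resample i)
  have hcomp : (fun x : PhaseSpace (n + 1) × ℝ => ((x.1.1, Function.update x.1.2 i x.2) : PhaseSpace (n + 1))) =
      Prod.snd ∘ fun x : PhaseSpace (n + 1) × ℝ =>
        (x.1.2 i, ((x.1.1, Function.update x.1.2 i x.2) : PhaseSpace (n + 1))) := rfl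
  rw [hcomp, ← Measure.map_map measurable_snd hm, h, Measure.map_snd_prod, measure_univ, one_smul]

/-- **The momentum `p_i` is `N(0,T)` under the Gibbs state**: `μ₀.map (p_i) = gaussianReal 0 T`. -/
theorem lightCone_gibbs_map_momentum (i : Fin (n + 1)) :
    ((pinnedChain ω₂ lam β γ).gibbsMeasure (n + 1) T).map (fun z : PhaseSpace (n + 1) => z.2 i) =
      gaussianReal 0 T.toNNReal := by
  haveI : IsProbabilityMeasure ((pinnedChain ω₂ lam β γ).gibbsMeasure (n + 1) T) :=
    pinnedChain_isProbabilityMeasure_gibbsMeasure hω hl hβ γ (n + 1) hT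
  have h := lightCone_gibbs_map_momentum_resample (γ := γ) hω hl hβ hT i (n := n)
  have hm : Measurable fun x : PhaseSpace (n + 1) × ℝ =>
      (x.1.2 i, ((x.1.1, Function.update x.1.2 i x.2) : PhaseSpace (n + 1))) :=
    ((measurable_pi_apply i).comp (measurable_snd.comp measurable_fst)).prodMk
      (lightCone_measurable_resample i)
  have hpi : Measurable fun z : PhaseSpace (n + 1) => z.2 i := (measurable_pi_apply i).comp measurable_snd
  have hcomp : (fun x : PhaseSpace (n + 1) × ℝ => x.1.2 i) =
      Prod.fst ∘ fun x : PhaseSpace (n + 1) × ℝ =>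
        (x.1.2 i, ((x.1.1, Function.update x.1.2 i x.2) : PhaseSpace (n + 1))) := rfl
  have h1 : (((pinnedChain ω₂ lam β γ).gibbsMeasure (n + 1) T).prod (gaussianReal 0 T.toNNReal)).map
      (fun x : PhaseSpace (n + 1) × ℝ => x.1.2 i) = gaussianReal 0 T.toNNReal := by
    rw [hcomp, ← Measure.map_map measurable_fst hm, h, Measure.map_fst_prod, measure_univ, one_smul]
  have h2 : (((pinnedChain ω₂ lam β γ).gibbsMeasure (n + 1) T).prod (gaussianReal 0 T.toNNReal)).map
      (fun x : PhaseSpace (n + 1) × ℝ => x.1.2 i) =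
      (((pinnedChain ω₂ lam β γ).gibbsMeasure (n + 1) T).map fun z : PhaseSpace (n + 1) => z.2 i) := by
    rw [show (fun x : PhaseSpace (n + 1) × ℝ => x.1.2 i) = (fun z : PhaseSpace (n + 1) => z.2 i) ∘ Prod.fst from rfl,
      ← Measure.map_map hpi measurable_fst, Measure.map_fst_prod, measure_univ, one_smul]
  rw [← h2, h1]

end Corollaries

end Summit.AtomisticToContinuum.FouriersLaw.Theorems.PhononMeanFreePath

end
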